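import Mathlib

/-!
# The leaf exponent is Lipschitz in the monodromy trace (hyperbolic side)

Solo-blind programme (AnomalousDissipation), steady-door line, §24.17 (8′)(β′)/(g-vii) of the working paper.

On a closed leaf of period `T` the columnar growth exponent `σ ≥ 0` of the area-preserving leaf
cocycle is read off the monodromy trace through `tr M = 2 cosh (σ T)`.  A perturbation of the
carrier (the pattern's mean flow) changes the trace by an amount that Grönwall bounds by the
leaf-integrated size of the perturbing velocity gradient; the lemmas below convert a trace change
into an exponent change with the sharp tangent constant: if `0 ≤ u' ≤ u` then
`2 sinh(u') (u - u') ≤ 2 cosh(u) - 2 cosh(u')` (convexity of `cosh`), i.e. the DROP of the exponent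
is at most the drop of the trace divided by `2 T sinh(σ' T)`.  This is the quantitative form of the
statement that the σ-reduction per unit pattern amplitude is bounded as long as the leaves stay
uniformly hyperbolic — the upper envelope used by the amplitude floor lemma.
-/

namespace Summit.AnomalousDissipation.AnomalousDissipation.Theorems

/-- Tangent-line (convexity) inequality for `cosh` at a point `u' ≥ 0`, towards the right:
`sinh u' · (u - u') ≤ cosh u - cosh u'` for `u' ≤ u`. -/
theorem sinh_mul_sub_le_cosh_sub_cosh {u u' : ℝ} (hu' : 0 ≤ u') (h : u' ≤ u) :
    Real.sinh u' * (u - u') ≤ Real.cosh u - Real.cosh u' := by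
  -- write u = u' + d with d ≥ 0 and expand cosh (u' + d)
  obtain ⟨d, hd, rfl⟩ : ∃ d, 0 ≤ d ∧ u = u' + d := ⟨u - u', by linarith, by ring⟩
  rw [Real.cosh_add]
  have h1 : 1 ≤ Real.cosh d := Real.one_le_cosh d
  have h2 : d ≤ Real.sinh d := Real.self_le_sinh_iff.mpr hd
  have h3 : 0 < Real.cosh u' := Real.cosh_pos u'
  have h4 : 0 ≤ Real.sinh u' := Real.sinh_nonneg_iff.mpr hu'
  have : u' + d - u' = d := by ring
  rw [this]
  nlinarith [mul_le_mul_of_nonneg_left h2 h4, mul_le_mul_of_nonneg_left h1 h3.le]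

/-- **Exponent drop ≤ trace drop / (2 sinh).** If `t = 2 cosh u` and `t' = 2 cosh u'` with
`0 ≤ u' ≤ u`, then `2 sinh(u') · (u - u') ≤ t - t'`. -/
theorem exponent_drop_le_trace_drop {u u' t t' : ℝ} (hu' : 0 ≤ u') (h : u' ≤ u)
    (ht : t = 2 * Real.cosh u) (ht' : t' = 2 * Real.cosh u') :
    2 * Real.sinh u' * (u - u') ≤ t - t' := by
  have := sinh_mul_sub_le_cosh_sub_cosh hu' h
  rw [ht, ht']; nlinarith [this]

/-- **Leaf exponents.** On a leaf of period `T > 0` let the unperturbed and perturbed exponents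
`0 ≤ σ' ≤ σ` be defined by `tr = 2 cosh (σ T)`, `tr' = 2 cosh (σ' T)`.  Then
`(σ - σ') · (2 T sinh (σ' T)) ≤ tr - tr'`: as long as the perturbed leaf stays hyperbolic with
`σ' T ≥ u₀ > 0`, the exponent drop is at most `(tr - tr') / (2 T sinh u₀)`. -/
theorem leaf_exponent_drop_le {σ σ' T tr tr' : ℝ} (hT : 0 < T) (hσ' : 0 ≤ σ') (h : σ' ≤ σ)
    (htr : tr = 2 * Real.cosh (σ * T)) (htr' : tr' = 2 * Real.cosh (σ' * T)) :
    (σ - σ') * (2 * T * Real.sinh (σ' * T)) ≤ tr - tr' := by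
  have hu' : 0 ≤ σ' * T := mul_nonneg hσ' hT.le
  have hle : σ' * T ≤ σ * T := mul_le_mul_of_nonneg_right h hT.le
  have key := exponent_drop_le_trace_drop hu' hle htr htr'
  -- 2 sinh(σ'T) (σT − σ'T) = (σ − σ') (2 T sinh(σ'T))
  have : 2 * Real.sinh (σ' * T) * (σ * T - σ' * T) = (σ - σ') * (2 * T * Real.sinh (σ' * T)) := by
    ring
  linarith [key, this]

/-- The same bound solved for the drop, under a uniform hyperbolicity floor `u₀ ≤ σ' T` with
`0 < u₀`: `σ - σ' ≤ (tr - tr') / (2 T sinh u₀)`. -/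
theorem leaf_exponent_drop_le_div {σ σ' T tr tr' u₀ : ℝ} (hT : 0 < T) (hu₀ : 0 < u₀)
    (hfloor : u₀ ≤ σ' * T) (h : σ' ≤ σ)
    (htr : tr = 2 * Real.cosh (σ * T)) (htr' : tr' = 2 * Real.cosh (σ' * T)) :
    σ - σ' ≤ (tr - tr') / (2 * T * Real.sinh u₀) := by
  have hσ' : 0 ≤ σ' := by
    rcases le_or_gt 0 σ' with hge | hneg
    · exact hge
    have : σ' * T < 0 := mul_neg_of_neg_of_pos hneg hT
    linarith
  have main := leaf_exponent_drop_le hT hσ' h htr htr'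
  have hsinh₀ : 0 < Real.sinh u₀ := Real.sinh_pos_iff.mpr hu₀
  have hsinh_mono : Real.sinh u₀ ≤ Real.sinh (σ' * T) := Real.sinh_le_sinh.mpr hfloor
  have hden : 0 < 2 * T * Real.sinh u₀ := by positivity
  rw [le_div_iff₀ hden]
  have hdrop : 0 ≤ σ - σ' := by linarith
  calc (σ - σ') * (2 * T * Real.sinh u₀) ≤ (σ - σ') * (2 * T * Real.sinh (σ' * T)) := by
        apply mul_le_mul_of_nonneg_left _ hdrop
        nlinarith [hsinh_mono, hT]
    _ ≤ tr - tr' := main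

end Summit.AnomalousDissipation.AnomalousDissipation.Theorems
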